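import Summits.Ventures.PercRepro.K5eForests

/-!
# PercRepro — the cycle matroid `M(K₅ ∖ e)` on `Fin 9` and its profile table (p9, gen 15)

On `K5eForests` (the circuits / forests of `K₅ ∖ e` and the augmentation axiom decided in the kernel): the rank `rk X` =
the largest forest inside `X`, the union-find rank `rkG` (`rkG_eq_rk`: equal on every edge set, one kernel decision per
number of edges), the matroid `K5e` by `IndepMatroid.ofFinset`, `eRk_coe : K5e.eRk ↑X = rk X`, and the profile table
`(rk X, rk Xᶜ)` over the 512 edge subsets, `(0,4)·1 (1,4)·9 (2,4)·43 (3,3)·16 (3,4)·129 (4,0)·1 (4,1)·9 (4,2)·43 (4,3)·129 (4,4)·132` (the fibre counts on the union-find profile, `sum_profile`,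
`four_le_rk_add_rk_compl`). Nothing here is about any window of S4.
-/

namespace PercRepro.K5eLadder

open Finset

/-- The rank of an edge set: the largest size of a forest inside it. -/
def rk (X : Finset (Fin 9)) : ℕ := (forests.filter (fun I => I ⊆ X)).sup Finset.card

/-- The profile of an edge set: `(rk X, rk Xᶜ)`. -/
def profile (X : Finset (Fin 9)) : ℕ × ℕ := (rk X, rk Xᶜ)

/-- The forests inside `X` are the independent subsets of `X`. -/
theorem filter_forests_eq (X : Finset (Fin 9)) :
    forests.filter (fun I => I ⊆ X) = X.powerset.filter indepF := by
  ext I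
  simp only [Finset.mem_filter, Finset.mem_powerset, indepF_iff]
  exact and_comm

/-- `rk X` is the largest size of an independent subset of `X`. -/
theorem rk_eq (X : Finset (Fin 9)) : rk X = (X.powerset.filter indepF).sup Finset.card := by
  rw [rk, filter_forests_eq]

/-- The endpoints of the edges of `K₅ ∖ e` (edge `i` joins `(ends i).1` and `(ends i).2`). -/
def ends : Fin 9 → Fin 5 × Fin 5 := ![(0, 1), (0, 2), (0, 3), (0, 4), (1, 2), (1, 3), (1, 4), (2, 3), (2, 4)]

/-- The root of a vertex under a parent function with depth at most `4` (4 hops). -/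
def root (par : Fin 5 → Fin 5) (v : Fin 5) : Fin 5 := par (par (par (par (par v))))

/-- One union-find step: an edge of `X` joining two different components merges them and raises the rank. -/
def ufStep (X : Finset (Fin 9)) (st : (Fin 5 → Fin 5) × ℕ) (e : Fin 9) : (Fin 5 → Fin 5) × ℕ :=
  if e ∈ X then
    if root st.1 (ends e).1 = root st.1 (ends e).2 then st
    else (Function.update st.1 (root st.1 (ends e).1) (root st.1 (ends e).2), st.2 + 1)
  else st

/-- The rank of an edge set by union-find over the edges in order (`5` vertices, `9` edges). -/
def rkG (X : Finset (Fin 9)) : ℕ := ((List.finRange 9).foldl (ufStep X) (id, 0)).2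

/-- The profile by union-find. -/
def profileG (X : Finset (Fin 9)) : ℕ × ℕ := (rkG X, rkG Xᶜ)

set_option maxHeartbeats 4000000 in
/-- Union-find computes the matroid rank on the edge sets with `0` edges (`C(9,0)` kernel evaluations of both). -/
theorem rkG_eq_rk_0 : ∀ X : Finset (Fin 9), X.card = 0 → rkG X = rk X := by decide +kernel

set_option maxHeartbeats 4000000 in
/-- Union-find computes the matroid rank on the edge sets with `1` edges (`C(9,1)` kernel evaluations of both). -/
theorem rkG_eq_rk_1 : ∀ X : Finset (Fin 9), X.card = 1 → rkG X = rk X := by decide +kernel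

set_option maxHeartbeats 4000000 in
/-- Union-find computes the matroid rank on the edge sets with `2` edges (`C(9,2)` kernel evaluations of both). -/
theorem rkG_eq_rk_2 : ∀ X : Finset (Fin 9), X.card = 2 → rkG X = rk X := by decide +kernel

set_option maxHeartbeats 4000000 in
/-- Union-find computes the matroid rank on the edge sets with `3` edges (`C(9,3)` kernel evaluations of both). -/
theorem rkG_eq_rk_3 : ∀ X : Finset (Fin 9), X.card = 3 → rkG X = rk X := by decide +kernel

set_option maxHeartbeats 4000000 in
/-- Union-find computes the matroid rank on the edge sets with `4` edges (`C(9,4)` kernel evaluations of both). -/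
theorem rkG_eq_rk_4 : ∀ X : Finset (Fin 9), X.card = 4 → rkG X = rk X := by decide +kernel

set_option maxHeartbeats 4000000 in
/-- Union-find computes the matroid rank on the edge sets with `5` edges (`C(9,5)` kernel evaluations of both). -/
theorem rkG_eq_rk_5 : ∀ X : Finset (Fin 9), X.card = 5 → rkG X = rk X := by decide +kernel

set_option maxHeartbeats 4000000 in
/-- Union-find computes the matroid rank on the edge sets with `6` edges (`C(9,6)` kernel evaluations of both). -/
theorem rkG_eq_rk_6 : ∀ X : Finset (Fin 9), X.card = 6 → rkG X = rk X := by decide +kernel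

set_option maxHeartbeats 4000000 in
/-- Union-find computes the matroid rank on the edge sets with `7` edges (`C(9,7)` kernel evaluations of both). -/
theorem rkG_eq_rk_7 : ∀ X : Finset (Fin 9), X.card = 7 → rkG X = rk X := by decide +kernel

set_option maxHeartbeats 4000000 in
/-- Union-find computes the matroid rank on the edge sets with `8` edges (`C(9,8)` kernel evaluations of both). -/
theorem rkG_eq_rk_8 : ∀ X : Finset (Fin 9), X.card = 8 → rkG X = rk X := by decide +kernel

set_option maxHeartbeats 4000000 in
/-- Union-find computes the matroid rank on the edge sets with `9` edges (`C(9,9)` kernel evaluations of both). -/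
theorem rkG_eq_rk_9 : ∀ X : Finset (Fin 9), X.card = 9 → rkG X = rk X := by decide +kernel

/-- **Union-find computes the matroid rank** on every edge set (by the number of edges). -/
theorem rkG_eq_rk (X : Finset (Fin 9)) : rkG X = rk X := by
  have h : X.card ≤ 9 := by simpa using Finset.card_le_univ X
  obtain ⟨n, hn⟩ : ∃ n, X.card = n := ⟨_, rfl⟩
  have hn9 : n ≤ 9 := hn ▸ h
  interval_cases n
  · exact rkG_eq_rk_0 X hn
  · exact rkG_eq_rk_1 X hn
  · exact rkG_eq_rk_2 X hn
  · exact rkG_eq_rk_3 X hn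
  · exact rkG_eq_rk_4 X hn
  · exact rkG_eq_rk_5 X hn
  · exact rkG_eq_rk_6 X hn
  · exact rkG_eq_rk_7 X hn
  · exact rkG_eq_rk_8 X hn
  · exact rkG_eq_rk_9 X hn

/-- The two profile functions agree. -/
theorem profileG_eq : profileG = profile := by
  funext X
  simp only [profileG, profile, rkG_eq_rk X, rkG_eq_rk Xᶜ]

/-- The profiles of `M(K₅ ∖ e)`. -/
theorem image_profileG : (univ : Finset (Finset (Fin 9))).image profileG = {(0, 4), (1, 4), (2, 4), (3, 3), (3, 4), (4, 0), (4, 1), (4, 2), (4, 3), (4, 4)} := by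
  decide +kernel

/-- The profile `(0, 4)` has multiplicity `1`. -/
theorem card_fibre_04 : #{X ∈ (univ : Finset (Finset (Fin 9))) | profileG X = (0, 4)} = 1 := by decide +kernel
/-- The profile `(1, 4)` has multiplicity `9`. -/
theorem card_fibre_14 : #{X ∈ (univ : Finset (Finset (Fin 9))) | profileG X = (1, 4)} = 9 := by decide +kernel
/-- The profile `(2, 4)` has multiplicity `43`. -/
theorem card_fibre_24 : #{X ∈ (univ : Finset (Finset (Fin 9))) | profileG X = (2, 4)} = 43 := by decide +kernel
/-- The profile `(3, 3)` has multiplicity `16`. -/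
theorem card_fibre_33 : #{X ∈ (univ : Finset (Finset (Fin 9))) | profileG X = (3, 3)} = 16 := by decide +kernel
/-- The profile `(3, 4)` has multiplicity `129`. -/
theorem card_fibre_34 : #{X ∈ (univ : Finset (Finset (Fin 9))) | profileG X = (3, 4)} = 129 := by decide +kernel
/-- The profile `(4, 0)` has multiplicity `1`. -/
theorem card_fibre_40 : #{X ∈ (univ : Finset (Finset (Fin 9))) | profileG X = (4, 0)} = 1 := by decide +kernel
/-- The profile `(4, 1)` has multiplicity `9`. -/
theorem card_fibre_41 : #{X ∈ (univ : Finset (Finset (Fin 9))) | profileG X = (4, 1)} = 9 := by decide +kernel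
/-- The profile `(4, 2)` has multiplicity `43`. -/
theorem card_fibre_42 : #{X ∈ (univ : Finset (Finset (Fin 9))) | profileG X = (4, 2)} = 43 := by decide +kernel
/-- The profile `(4, 3)` has multiplicity `129`. -/
theorem card_fibre_43 : #{X ∈ (univ : Finset (Finset (Fin 9))) | profileG X = (4, 3)} = 129 := by decide +kernel
/-- The profile `(4, 4)` has multiplicity `132`. -/
theorem card_fibre_44 : #{X ∈ (univ : Finset (Finset (Fin 9))) | profileG X = (4, 4)} = 132 := by decide +kernel

/-- `4 ≤ rk X + rk Xᶜ` for every edge set (every profile of `M(K₅ ∖ e)` has `k₁ + k₂ ≥ 4`; from the table). -/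
theorem four_le_rk_add_rk_compl (X : Finset (Fin 9)) : 4 ≤ rk X + rk Xᶜ := by
  have h : profileG X ∈ (univ : Finset (Finset (Fin 9))).image profileG := Finset.mem_image_of_mem _ (mem_univ X)
  rw [image_profileG, profileG_eq] at h
  simp only [Finset.mem_insert, Finset.mem_singleton, profile, Prod.mk.injEq] at h
  omega

/-- **The profile table of `M(K₅ ∖ e)`**: any sum over the 512 edge subsets of a function of the profile
`(rk X, rk Xᶜ)` is `F(0,4) + 9·F(1,4) + 43·F(2,4) + 16·F(3,3) + 129·F(3,4) + F(4,0) + 9·F(4,1) + 43·F(4,2) + 129·F(4,3) + 132·F(4,4)`. -/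
theorem sum_profile (F : ℕ × ℕ → ℕ) :
    ∑ X : Finset (Fin 9), F (profile X) = F (0, 4) + 9 * F (1, 4) + 43 * F (2, 4) + 16 * F (3, 3)
      + 129 * F (3, 4) + F (4, 0) + 9 * F (4, 1) + 43 * F (4, 2) + 129 * F (4, 3)
      + 132 * F (4, 4) := by
  rw [← profileG_eq, Finset.sum_comp, image_profileG]
  rw [Finset.sum_insert (by decide), Finset.sum_insert (by decide), Finset.sum_insert (by decide), Finset.sum_insert (by decide), Finset.sum_insert (by decide), Finset.sum_insert (by decide), Finset.sum_insert (by decide), Finset.sum_insert (by decide), Finset.sum_insert (by decide), Finset.sum_singleton, card_fibre_04, card_fibre_14, card_fibre_24, card_fibre_33, card_fibre_34, card_fibre_40, card_fibre_41, card_fibre_42, card_fibre_43, card_fibre_44]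
  simp only [smul_eq_mul, one_mul]
  ring

/-! ### The matroid -/

/-- **The cycle matroid `M(K₅ ∖ e)`** on `Fin 9`, from the independence axioms of the forests. -/
def K5e : Matroid (Fin 9) :=
  (IndepMatroid.ofFinset (E := (Set.univ : Set (Fin 9))) indepF indepF_empty
    (fun _ _ hJ hIJ => indepF_subset hJ hIJ) (fun _ _ hI hJ h => indepF_aug _ _ hI hJ h)
    (fun _ _ => Set.subset_univ _)).matroid

/-- The ground set of `K5e` is `Fin 9`. -/
theorem K5e_ground : K5e.E = Set.univ := rfl

/-- `M(K₅ ∖ e)` is a finite matroid. -/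
theorem K5e_finite : K5e.Finite := ⟨Set.finite_univ⟩

/-- Independence in `K5e` is `indepF`. -/
theorem K5e_indep_iff (I : Finset (Fin 9)) : K5e.Indep ↑I ↔ indepF I := by
  rw [K5e, IndepMatroid.matroid_indep_iff, IndepMatroid.ofFinset_indep]

/-- **The rank function of `M(K₅ ∖ e)`** is `rk`. -/
theorem eRk_coe (X : Finset (Fin 9)) : K5e.eRk ↑X = (rk X : ℕ∞) := by
  rw [rk_eq]
  apply le_antisymm
  · rw [Matroid.eRk_le_iff]
    intro I hIX hI
    obtain ⟨J, rfl⟩ := (Set.toFinite I).exists_finset_coe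
    rw [K5e_indep_iff] at hI
    rw [Set.encard_coe_eq_coe_finsetCard]
    exact_mod_cast Finset.le_sup (f := Finset.card)
      (Finset.mem_filter.2 ⟨Finset.mem_powerset.2 (Finset.coe_subset.1 hIX), hI⟩)
  · rw [Matroid.le_eRk_iff]
    obtain ⟨J, hJ, hJsup⟩ := Finset.exists_mem_eq_sup (X.powerset.filter indepF)
      ⟨∅, Finset.mem_filter.2 ⟨Finset.mem_powerset.2 (Finset.empty_subset X), indepF_empty⟩⟩ Finset.card
    rw [Finset.mem_filter, Finset.mem_powerset] at hJ
    exact ⟨↑J, Finset.coe_subset.2 hJ.1, (K5e_indep_iff J).2 hJ.2,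
      by rw [Set.encard_coe_eq_coe_finsetCard, hJsup]⟩

/-- The rank of the complement of an edge set. -/
theorem eRk_compl_coe (X : Finset (Fin 9)) : K5e.eRk (K5e.E \ ↑X) = (rk Xᶜ : ℕ∞) := by
  rw [K5e_ground, ← Set.compl_eq_univ_sdiff, ← Finset.coe_compl, eRk_coe]

end PercRepro.K5eLadder
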